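import Summits.KontsevichZagierPeriods.Zeta5Search.TwoTaleP15LineBoundRate
import Summits.KontsevichZagierPeriods.Zeta5Search.TwoTaleLineBoundRC
import Summits.KontsevichZagierPeriods.Zeta5Search.Denom.TwoTaleR3Forms

/-!
# Rung A `(6,5,4,7 | 0,1,2,12)`: the scaled line bound `log ‖Rₙ‖ ≤ n·rateA(η) + O(log n + log(484+η²))` on `x = ⌊23n/10⌋ + ½`

HONEST FRAMING: systematic search; no irrationality claim unless certified.  Cell pub-zeta5, class `measure`
(fam-measure g4), T3/T4.  No measure or irrationality claim: this is the rung-A clone of P1 g9's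
`TwoTaleP15LineBoundRate` — the real-variable upper bound for the modulus of Zudilin's rational function
`Rₙ(s) = Zudilin2014.RC (aRungA n) (bRungA n) s` ([Zudilin2014ZetaTwo, §3, Remark 3]: `a = (6n+1, 5n+1, 4n+1, 7n+1)`,
`b = (1, n+1, 2n+1, 12n+2)`, `a₂* = 5n+1`) on the vertical line `Re s = uₙ = xₙ + ½ − a₂*`, `xₙ = ⌊23n/10⌋`
(the abscissa agreed with fam-denom g7, INBOX 2026-08-21 06:40Z/06:45Z), written at height `Im s = nη`:

* `rateA η = Σ± prim η Vᵢ* + 7 + κ_A`, `V* = (33/10, −27/10 | 23/10, −17/10 | 13/10, −7/10 ‖ 93/10, 43/10)`,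
  `κ_A = 5 log 5 − 6 log 6 − 4 log 4 − 2 log 2`, `prim η V = V·½log(V²+η²) − V + η·arctan(V/η)`
  (P1's `TwoTaleLineBound.prim`; fam-denom's `profileA0 (23/10) η` in their normalisation);
* **`log_norm_RCA_line_le`**: for `n ≥ 3`, `η ≠ 0`,
  `log ‖RC (aRungA n) (bRungA n) (uₙ + i·nη)‖ ≤ n·rateA η + 2·log n + 9·log(484 + η²) + K0A`,
  `K0A = 12|log(1/5)| + 3(1+log 2) + 1`.
Ingredients (all tree): P1's GENERAL block bound `log_norm_RC_le`, `prim_scale`/`halfLog_scale`,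
`abs_prim_sub_prim_le` (endpoint offsets `|E − nV*| ≤ 3/2`; the shortest leg `|V*| = 7/10` forces `n ≥ 3` so that
the segment stays inside `1/5 ≤ |W| ≤ 22`), `halfLog_endpoint`, `log_factorial_two_sided` (the `n log n` terms:
`+7 n log n` from the blocks against `−7 n log n` from `Π = (5n)!/((6n)!(4n)!(2n)!)`).
What remains for `DecayA c`: fam-denom's certificate `∀ η ≠ 0, rateA η − (2π−δ)|η| ≤ M` (numerically
`sup = −13.22912` at `η = ±0.9263`) and the `dy`-assembly (`TwoTaleRungALineDecay`).
-/

noncomputable section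

open Real Complex
open Literature.NumberTheory.Irrationality.Zudilin2014
open Summit.KontsevichZagierPeriods.Zeta5Search.Denom.TwoTaleR3Forms
open Summit.KontsevichZagierPeriods.Zeta5Search.TwoTaleLineBound

namespace Summit.KontsevichZagierPeriods.Zeta5Search.TwoTaleRungALine

/-- The abscissa `xₙ = ⌊23n/10⌋` (agreed with fam-denom g7: the line `ξ = 23/10`). -/
def xLineA (n : ℕ) : ℕ := 23 * n / 10

/-- `uₙ = xₙ + ½ − (5n+1)`, the real part of the argument of `Rₙ` on the line. -/
def uLineA (n : ℕ) : ℝ := (xLineA n : ℝ) + 1 / 2 - (5 * n + 1)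

/-- The entropy row `κ_A = 5 log 5 − 6 log 6 − 4 log 4 − 2 log 2` of `Π = (5n)!/((6n)!(4n)!(2n)!)`. -/
def kappaA : ℝ := 5 * Real.log 5 - 6 * Real.log 6 - 4 * Real.log 4 - 2 * Real.log 2

/-- **The rung-A rate function** `rateA η = Σ± prim η Vᵢ* + 7 + κ_A` (interface fixed with fam-denom g7). -/
def rateA (η : ℝ) : ℝ :=
  (prim η (33 / 10) - prim η (-27 / 10)) + (prim η (23 / 10) - prim η (-17 / 10)) + (prim η (13 / 10) - prim η (-7 / 10))
    - (prim η (93 / 10) - prim η (43 / 10)) + 7 + kappaA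

/-- The Lipschitz constant of `prim η ·` on `1/5 ≤ |W| ≤ 22`. -/
def lipKA (η : ℝ) : ℝ := |Real.log (1 / 5)| + Real.log (22 ^ 2 + η ^ 2) / 2

/-- The constant `K0A = 12|log(1/5)| + 3(1 + log 2) + 1` of the line bound. -/
def K0A : ℝ := 12 * |Real.log (1 / 5)| + 3 * (1 + Real.log 2) + 1

/-- `xₙ ≤ 4n` (the line lies in the strip-shift range of `TwoTaleRungAStripShift`). -/
theorem xLineA_le (n : ℕ) : xLineA n ≤ 4 * n := by
  unfold xLineA
  omega

/-- Floor bookkeeping: `−3/2 ≤ uₙ + 27n/10 ≤ −1/2`. -/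
theorem uLineA_bounds (n : ℕ) : -3 / 2 ≤ uLineA n + 27 * n / 10 ∧ uLineA n + 27 * n / 10 ≤ -1 / 2 := by
  unfold uLineA xLineA
  have h1 : 10 * (23 * n / 10) ≤ 23 * n := Nat.mul_div_le _ _
  have h2 : 23 * n < 10 * (23 * n / 10) + 10 := by omega
  have h1' : (10 : ℝ) * ((23 * n / 10 : ℕ) : ℝ) ≤ 23 * n := by exact_mod_cast h1
  have h2' : (23 : ℝ) * n < 10 * ((23 * n / 10 : ℕ) : ℝ) + 10 := by exact_mod_cast h2
  constructor <;> linarith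

variable {η : ℝ}

/-- `lipKA η ≥ 0`. -/
theorem lipKA_nonneg (η : ℝ) : 0 ≤ lipKA η := by
  unfold lipKA
  have : 0 ≤ Real.log (22 ^ 2 + η ^ 2) := Real.log_nonneg (by nlinarith [sq_nonneg η])
  positivity

/-- **Endpoint transfer**: an endpoint `E` with `|E − nV*| ≤ 3/2`, `7/10 ≤ |V*| ≤ 93/10`, satisfies
`|prim (nη) E − (n·prim η V* + E·log n)| ≤ (3/2)·lipKA η` (`n ≥ 3`, `η ≠ 0`; then `|E/n − V*| ≤ 1/2` keeps the
segment inside `1/5 ≤ |W| ≤ 22`). -/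
theorem prim_endpointA (hη : η ≠ 0) {n : ℕ} (hn : 3 ≤ n) {E Vs : ℝ} (hE : |E - n * Vs| ≤ 3 / 2)
    (hV1 : 7 / 10 ≤ |Vs|) (hV2 : |Vs| ≤ 93 / 10) :
    |prim (n * η) E - (n * prim η Vs + E * Real.log n)| ≤ 3 / 2 * lipKA η := by
  have hn0 : (0 : ℝ) < n := by exact_mod_cast (show 0 < n by omega)
  have hn3 : (3 : ℝ) ≤ n := by exact_mod_cast hn
  obtain ⟨V, hV⟩ : ∃ V : ℝ, V = E / n := ⟨_, rfl⟩
  have hEV : E = n * V := by rw [hV]; field_simp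
  rw [hEV, prim_scale hn0 hη V, show (n : ℝ) * prim η V + n * V * Real.log n - (n * prim η Vs + n * V * Real.log n) =
    n * (prim η V - prim η Vs) by ring, abs_mul, abs_of_pos hn0]
  have hdist : (n : ℝ) * |V - Vs| ≤ 3 / 2 := by
    have : |E - n * Vs| = n * |V - Vs| := by rw [hEV, ← mul_sub, abs_mul, abs_of_pos hn0]
    rw [← this]; exact hE
  have hdist' : |V - Vs| ≤ 1 / 2 := by
    nlinarith [abs_nonneg (V - Vs), mul_nonneg (sub_nonneg.2 hn3) (abs_nonneg (V - Vs))]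
  have hseg : ∀ W ∈ Set.uIcc Vs V, 1 / 5 ≤ |W| ∧ |W| ≤ 22 := by
    intro W hW
    have hWd : |W - Vs| ≤ |V - Vs| := Set.abs_sub_left_of_mem_uIcc hW
    have h1 : |Vs| - |W - Vs| ≤ |W| := by
      have := abs_sub_abs_le_abs_sub Vs W
      rw [abs_sub_comm] at this
      linarith
    have h2 : |W| ≤ |Vs| + |W - Vs| := by
      have := abs_add_le Vs (W - Vs)
      simpa using this
    constructor <;> linarith
  have hL := abs_prim_sub_prim_le hη (m := 1 / 5) (M := 22) (by norm_num) (by norm_num) hseg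
  have hK := lipKA_nonneg η
  calc (n : ℝ) * |prim η V - prim η Vs| ≤ n * ((|Real.log (1 / 5)| + Real.log (22 ^ 2 + η ^ 2) / 2) * |V - Vs|) :=
        mul_le_mul_of_nonneg_left hL hn0.le
    _ = lipKA η * (n * |V - Vs|) := by unfold lipKA; ring
    _ ≤ lipKA η * (3 / 2) := mul_le_mul_of_nonneg_left hdist hK
    _ = 3 / 2 * lipKA η := by ring

/-! ### Stirling for `Π = (5n)!/((6n)!(4n)!(2n)!)` -/

/-- `Π` at rung A as factorials: `Pi (aRungA n) (bRungA n) = (5n)!/((6n)!(4n)!(2n)!)`. -/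
theorem PiA_eq (n : ℕ) : Pi (aRungA n) (bRungA n) =
    ((5 * n).factorial : ℚ) / (((6 * n).factorial : ℚ) * ((4 * n).factorial : ℚ) * ((2 * n).factorial : ℚ)) := by
  have e3 : (bRungA n 3 - aRungA n 3 - 1).toNat = 5 * n := by rw [aRungA_three, bRungA_three]; omega
  have e0 : (aRungA n 0 - bRungA n 0).toNat = 6 * n := by rw [aRungA_zero, bRungA_zero]; omega
  have e1 : (aRungA n 1 - bRungA n 1).toNat = 4 * n := by rw [aRungA_one, bRungA_one]; omega
  have e2 : (aRungA n 2 - bRungA n 2).toNat = 2 * n := by rw [aRungA_two, bRungA_two]; omega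
  unfold Pi numFac facZ
  rw [e0, e1, e2, e3]

/-- `log |Π| = log (5n)! − log (6n)! − log (4n)! − log (2n)!`. -/
theorem log_abs_PiA (n : ℕ) : Real.log |((Pi (aRungA n) (bRungA n) : ℚ) : ℝ)| =
    Real.log ((5 * n).factorial : ℝ) - Real.log ((6 * n).factorial : ℝ) - Real.log ((4 * n).factorial : ℝ)
      - Real.log ((2 * n).factorial : ℝ) := by
  rw [PiA_eq]
  push_cast
  have h : ∀ k : ℕ, (0 : ℝ) < (k.factorial : ℝ) := fun k => by exact_mod_cast Nat.factorial_pos k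
  rw [abs_of_pos (div_pos (h _) (mul_pos (mul_pos (h _) (h _)) (h _))),
    Real.log_div (h _).ne' (mul_pos (mul_pos (h _) (h _)) (h _)).ne',
    Real.log_mul (mul_pos (h _) (h _)).ne' (h _).ne', Real.log_mul (h _).ne' (h _).ne']
  ring

/-- **Stirling for `log |Π|`**: `log |Π| ≤ −7·n log n + n·κ_A + 7n − log n + 1` (`n ≥ 1`). -/
theorem log_abs_PiA_le {n : ℕ} (hn : 1 ≤ n) :
    Real.log |((Pi (aRungA n) (bRungA n) : ℚ) : ℝ)| ≤ -7 * (n * Real.log n) + n * kappaA + 7 * n - Real.log n + 1 := by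
  have hn0 : (0 : ℝ) < n := by exact_mod_cast hn
  rw [log_abs_PiA]
  have c5 : Real.log ((5 * n : ℕ) : ℝ) = Real.log 5 + Real.log n := by
    push_cast; exact Real.log_mul (by norm_num) hn0.ne'
  have c6 : Real.log ((6 * n : ℕ) : ℝ) = Real.log 6 + Real.log n := by
    push_cast; exact Real.log_mul (by norm_num) hn0.ne'
  have c4 : Real.log ((4 * n : ℕ) : ℝ) = Real.log 4 + Real.log n := by
    push_cast; exact Real.log_mul (by norm_num) hn0.ne'
  have c2 : Real.log ((2 * n : ℕ) : ℝ) = Real.log 2 + Real.log n := by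
    push_cast; exact Real.log_mul (by norm_num) hn0.ne'
  have s5 := (log_factorial_two_sided (n := 5 * n) (by omega)).2
  have s6 := (log_factorial_two_sided (n := 6 * n) (by omega)).1
  have s4 := (log_factorial_two_sided (n := 4 * n) (by omega)).1
  have s2 := (log_factorial_two_sided (n := 2 * n) (by omega)).1
  rw [c5] at s5; rw [c6] at s6; rw [c4] at s4; rw [c2] at s2
  simp only [Nat.cast_mul, Nat.cast_ofNat] at s5 s6 s4 s2
  have q5 : (5 * (n : ℝ)) * (Real.log 5 + Real.log n) = 5 * (n * Real.log 5) + 5 * (n * Real.log n) := by ring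
  have q6 : (6 * (n : ℝ)) * (Real.log 6 + Real.log n) = 6 * (n * Real.log 6) + 6 * (n * Real.log n) := by ring
  have q4 : (4 * (n : ℝ)) * (Real.log 4 + Real.log n) = 4 * (n * Real.log 4) + 4 * (n * Real.log n) := by ring
  have q2 : (2 * (n : ℝ)) * (Real.log 2 + Real.log n) = 2 * (n * Real.log 2) + 2 * (n * Real.log n) := by ring
  have hκ : (n : ℝ) * kappaA = 5 * (n * Real.log 5) - 6 * (n * Real.log 6) - 4 * (n * Real.log 4) - 2 * (n * Real.log 2) := by
    unfold kappaA; ring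
  have hlog56 : Real.log 5 ≤ Real.log 6 := Real.log_le_log (by norm_num) (by norm_num)
  have hlog4 : 0 ≤ Real.log 4 := Real.log_nonneg (by norm_num)
  have hlog2 : 0 ≤ Real.log 2 := Real.log_nonneg (by norm_num)
  rw [hκ]
  linarith

/-! ### The line bound -/

set_option maxHeartbeats 400000 in
/-- **The scaled line bound at rung A**: for `n ≥ 3`, `η ≠ 0`,
`log ‖RC (aRungA n) (bRungA n) (uₙ + i·nη)‖ ≤ n·rateA η + 2 log n + 9 log(22² + η²) + K0A`. -/
theorem log_norm_RCA_line_le (hη : η ≠ 0) {n : ℕ} (hn : 3 ≤ n) :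
    Real.log ‖RC (aRungA n) (bRungA n) ((uLineA n : ℂ) + (((n : ℝ) * η : ℝ) : ℂ) * I)‖ ≤
      n * rateA η + 2 * Real.log n + 9 * Real.log (22 ^ 2 + η ^ 2) + K0A := by
  have hnN : 1 ≤ n := by omega
  have hn0 : (0 : ℝ) < n := by exact_mod_cast (show 0 < n by omega)
  have hn1 : (1 : ℝ) ≤ n := by exact_mod_cast hnN
  have hy : (n : ℝ) * η ≠ 0 := mul_ne_zero hn0.ne' hη
  obtain ⟨hu1, hu2⟩ := uLineA_bounds n
  set u : ℝ := uLineA n with hu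
  -- the general block bound, instantiated at rung A
  have hlen : ∀ j : Fin 4, j ≠ 3 → bRungA n j + 2 ≤ aRungA n j := by
    intro j hj
    fin_cases j <;> simp at hj ⊢ <;> omega
  have hden : aRungA n 3 < bRungA n 3 := by rw [aRungA_three, bRungA_three]; omega
  have c3a : ((aRungA n 3 : ℤ) : ℝ) = 7 * n + 1 := by rw [aRungA_three]; push_cast; ring
  have hu' : 1 ≤ u + ((aRungA n 3 : ℤ) : ℝ) := by rw [c3a]; linarith
  have hB := log_norm_RC_le hy hlen hden hu'
  have c0 : ((aRungA n 0 - 1 : ℤ) : ℝ) = 6 * n := by rw [aRungA_zero]; push_cast; ring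
  have c0b : ((bRungA n 0 : ℤ) : ℝ) = 1 := by simp
  have c1 : ((aRungA n 1 - 1 : ℤ) : ℝ) = 5 * n := by rw [aRungA_one]; push_cast; ring
  have c1b : ((bRungA n 1 : ℤ) : ℝ) = n + 1 := by rw [bRungA_one]; push_cast; ring
  have c2 : ((aRungA n 2 - 1 : ℤ) : ℝ) = 4 * n := by rw [aRungA_two]; push_cast; ring
  have c2b : ((bRungA n 2 : ℤ) : ℝ) = 2 * n + 1 := by rw [bRungA_two]; push_cast; ring
  have c3 : ((bRungA n 3 - 1 : ℤ) : ℝ) = 12 * n + 1 := by rw [bRungA_three]; push_cast; ring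
  rw [c0, c0b, c1, c1b, c2, c2b, c3, c3a] at hB
  -- the eight endpoints
  have a1 : (7:ℝ) / 10 ≤ |(33:ℝ) / 10| ∧ |(33:ℝ) / 10| ≤ 93 / 10 := by rw [abs_of_pos (by norm_num)]; norm_num
  have a2 : (7:ℝ) / 10 ≤ |(-27:ℝ) / 10| ∧ |(-27:ℝ) / 10| ≤ 93 / 10 := by rw [abs_of_neg (by norm_num)]; norm_num
  have a3 : (7:ℝ) / 10 ≤ |(23:ℝ) / 10| ∧ |(23:ℝ) / 10| ≤ 93 / 10 := by rw [abs_of_pos (by norm_num)]; norm_num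
  have a4 : (7:ℝ) / 10 ≤ |(-17:ℝ) / 10| ∧ |(-17:ℝ) / 10| ≤ 93 / 10 := by rw [abs_of_neg (by norm_num)]; norm_num
  have a5 : (7:ℝ) / 10 ≤ |(13:ℝ) / 10| ∧ |(13:ℝ) / 10| ≤ 93 / 10 := by rw [abs_of_pos (by norm_num)]; norm_num
  have a6 : (7:ℝ) / 10 ≤ |(-7:ℝ) / 10| ∧ |(-7:ℝ) / 10| ≤ 93 / 10 := by rw [abs_of_neg (by norm_num)]; norm_num
  have a7 : (7:ℝ) / 10 ≤ |(93:ℝ) / 10| ∧ |(93:ℝ) / 10| ≤ 93 / 10 := by rw [abs_of_pos (by norm_num)]; norm_num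
  have a8 : (7:ℝ) / 10 ≤ |(43:ℝ) / 10| ∧ |(43:ℝ) / 10| ≤ 93 / 10 := by rw [abs_of_pos (by norm_num)]; norm_num
  obtain ⟨e1a, e1b⟩ := abs_le.1 (prim_endpointA hη hn (E := u + 6 * n) (Vs := 33 / 10)
    (by rw [abs_le]; constructor <;> linarith) a1.1 a1.2)
  obtain ⟨e2a, e2b⟩ := abs_le.1 (prim_endpointA hη hn (E := u + 1) (Vs := -27 / 10)
    (by rw [abs_le]; constructor <;> linarith) a2.1 a2.2)
  obtain ⟨e3a, e3b⟩ := abs_le.1 (prim_endpointA hη hn (E := u + 5 * n) (Vs := 23 / 10)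
    (by rw [abs_le]; constructor <;> linarith) a3.1 a3.2)
  obtain ⟨e4a, e4b⟩ := abs_le.1 (prim_endpointA hη hn (E := u + (n + 1)) (Vs := -17 / 10)
    (by rw [abs_le]; constructor <;> linarith) a4.1 a4.2)
  obtain ⟨e5a, e5b⟩ := abs_le.1 (prim_endpointA hη hn (E := u + 4 * n) (Vs := 13 / 10)
    (by rw [abs_le]; constructor <;> linarith) a5.1 a5.2)
  obtain ⟨e6a, e6b⟩ := abs_le.1 (prim_endpointA hη hn (E := u + (2 * n + 1)) (Vs := -7 / 10)
    (by rw [abs_le]; constructor <;> linarith) a6.1 a6.2)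
  obtain ⟨e7a, e7b⟩ := abs_le.1 (prim_endpointA hη hn (E := u + (12 * n + 1)) (Vs := 93 / 10)
    (by rw [abs_le]; constructor <;> linarith) a7.1 a7.2)
  obtain ⟨e8a, e8b⟩ := abs_le.1 (prim_endpointA hη hn (E := u + (7 * n + 1) - 1) (Vs := 43 / 10)
    (by rw [abs_le]; constructor <;> linarith) a8.1 a8.2)
  -- the six endpoint halfLog terms
  have l1 := halfLog_endpoint hη hnN (E := u + 1) (by rw [abs_le]; constructor <;> linarith)
  have l2 := halfLog_endpoint hη hnN (E := u + 6 * n) (by rw [abs_le]; constructor <;> linarith)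
  have l3 := halfLog_endpoint hη hnN (E := u + (n + 1)) (by rw [abs_le]; constructor <;> linarith)
  have l4 := halfLog_endpoint hη hnN (E := u + 5 * n) (by rw [abs_le]; constructor <;> linarith)
  have l5 := halfLog_endpoint hη hnN (E := u + (2 * n + 1)) (by rw [abs_le]; constructor <;> linarith)
  have l6 := halfLog_endpoint hη hnN (E := u + 4 * n) (by rw [abs_le]; constructor <;> linarith)
  -- Stirling
  have hP := log_abs_PiA_le hnN
  have hlogn : 0 ≤ Real.log n := Real.log_nonneg hn1
  -- linearise the products (each product is an atom for `linarith`)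
  have p1 : (u + 6 * n) * Real.log n = u * Real.log n + 6 * (n * Real.log n) := by ring
  have p2 : (u + 1) * Real.log n = u * Real.log n + Real.log n := by ring
  have p3 : (u + 5 * n) * Real.log n = u * Real.log n + 5 * (n * Real.log n) := by ring
  have p4 : (u + (n + 1)) * Real.log n = u * Real.log n + (n * Real.log n) + Real.log n := by ring
  have p5 : (u + 4 * n) * Real.log n = u * Real.log n + 4 * (n * Real.log n) := by ring
  have p6 : (u + (2 * n + 1)) * Real.log n = u * Real.log n + 2 * (n * Real.log n) + Real.log n := by ring
  have p7 : (u + (12 * n + 1)) * Real.log n = u * Real.log n + 12 * (n * Real.log n) + Real.log n := by ring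
  have p8 : (u + (7 * n + 1) - 1) * Real.log n = u * Real.log n + 7 * (n * Real.log n) := by ring
  have hG : (n : ℝ) * rateA η = n * prim η (33 / 10) - n * prim η (-27 / 10) + (n * prim η (23 / 10) - n * prim η (-17 / 10))
      + (n * prim η (13 / 10) - n * prim η (-7 / 10)) - (n * prim η (93 / 10) - n * prim η (43 / 10)) + 7 * n
      + n * kappaA := by
    unfold rateA; ring
  have hK := lipKA_nonneg η
  have hKdef : lipKA η = |Real.log (1 / 5)| + Real.log (22 ^ 2 + η ^ 2) / 2 := rfl
  have hK0 : K0A = 12 * |Real.log (1 / 5)| + 3 * (1 + Real.log 2) + 1 := rfl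
  rw [hG, hK0]
  linarith [e1a, e1b, e2a, e2b, e3a, e3b, e4a, e4b, e5a, e5b, e6a, e6b, e7a, e7b, e8a, e8b, l1, l2, l3, l4, l5, l6,
    hP, p1, p2, p3, p4, p5, p6, p7, p8, hB, hK, hKdef, hlogn]

end Summit.KontsevichZagierPeriods.Zeta5Search.TwoTaleRungALine

end
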